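import Literature.Geometry.Riemannian.SphericalCylinderEntropy

/-!
# Candidate proof of stub A' (`stub_harnackRadial_of_convex`) of line `ball-mass-slack`
(crux `CylinderEntropy.ThinCrossSectionExists`, stmt-SmoothPoincare4-7633) — refuter drefute evidence, NOT a landing.

Statement copied verbatim from `Cruxes/ThinCrossSectionExists/Lines/ball-mass-slack.lean` (lead reshape r1):
H (positivity + convexity of `θ ↦ log 𝔥(τ, cos θ) + θ²/4τ` on `[-π, π]`) ⇒ A (`θ ↦ 𝔥(τ, cos θ)·e^{θ²/4τ}` non-decreasing on `[0, π]`).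
Proof: the convex function is even, so for `0 ≤ a ≤ b ≤ π`, `a = l·(-b) + (1-l)·b` with `l = (b-a)/(2b) ∈ [0,1]` gives
`φ a ≤ l φ(-b) + (1-l) φ b = φ b`; exponentiate (`exp ∘ log = id` by positivity).
-/

open Literature.Geometry.Riemannian.SphericalCylinderEntropy (zonal)

namespace Refuter.Drefute7633

theorem harnackRadial_of_convex :
    (∀ τ : ℝ, 0 < τ →
        (∀ θ : ℝ, 0 < zonal τ (Real.cos θ)) ∧
          ConvexOn ℝ (Set.Icc (-Real.pi) Real.pi)
            (fun θ : ℝ => Real.log (zonal τ (Real.cos θ)) + θ ^ 2 / (4 * τ))) →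
      ∀ τ : ℝ, 0 < τ →
        MonotoneOn (fun θ : ℝ => zonal τ (Real.cos θ) * Real.exp (θ ^ 2 / (4 * τ))) (Set.Icc 0 Real.pi) := by
  intro hH τ hτ
  obtain ⟨hpos, hconv⟩ := hH τ hτ
  set φ : ℝ → ℝ := fun θ : ℝ => Real.log (zonal τ (Real.cos θ)) + θ ^ 2 / (4 * τ) with hφ
  have heven : ∀ θ : ℝ, φ (-θ) = φ θ := by
    intro θ
    simp only [hφ, Real.cos_neg, neg_sq]
  have hexp : ∀ θ : ℝ, zonal τ (Real.cos θ) * Real.exp (θ ^ 2 / (4 * τ)) = Real.exp (φ θ) := by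
    intro θ
    simp only [hφ, Real.exp_add, Real.exp_log (hpos θ)]
  intro a ha b hb hab
  show zonal τ (Real.cos a) * Real.exp (a ^ 2 / (4 * τ)) ≤ zonal τ (Real.cos b) * Real.exp (b ^ 2 / (4 * τ))
  rw [hexp, hexp, Real.exp_le_exp]
  rcases eq_or_lt_of_le hb.1 with hb0 | hb0
  · -- b = 0, hence a = 0
    have ha0 : a = 0 := le_antisymm (hb0 ▸ hab) ha.1
    rw [ha0, ← hb0]
  · have hbm : -b ∈ Set.Icc (-Real.pi) Real.pi := ⟨by linarith [hb.2], by linarith [Real.pi_pos]⟩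
    have hbp : b ∈ Set.Icc (-Real.pi) Real.pi := ⟨by linarith [Real.pi_pos], hb.2⟩
    set l : ℝ := (b - a) / (2 * b) with hl
    have hl0 : 0 ≤ l := div_nonneg (by linarith) (by linarith)
    have hl1 : l ≤ 1 := by
      rw [hl, div_le_one (by linarith)]
      linarith [ha.1]
    have key := hconv.2 hbm hbp hl0 (by linarith : 0 ≤ 1 - l) (by ring : l + (1 - l) = 1)
    have hcomb : l • (-b) + (1 - l) • b = a := by
      simp only [smul_eq_mul, hl]
      field_simp
      ring
    rw [hcomb, heven, smul_eq_mul, smul_eq_mul] at key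
    calc φ a ≤ l * φ b + (1 - l) * φ b := key
      _ = φ b := by ring

end Refuter.Drefute7633
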